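import Literature.MathematicalPhysics.QuantumLattice.LTQO
import Literature.MathematicalPhysics.QuantumLattice.SpinSystemProofs
import HarnessLib

/-!
# Discharges for local topological quantum order (`LTQO`)

Trunk QLatticeAQFT (item Q11 `LTQO`), family `hubbard` (Michalakis–Zwolak stability, hubbard.S19).
Sibling proof file of `Literature/MathematicalPhysics/QuantumLattice/LTQO.lean`: it discharges
named facts (`def X : Prop`, D-0014) of that file as `theorem X_holds : X`, from Mathlib and the
API already proved there. No statement is introduced or changed here.

Discharged:

* `Literature.QLattice.localGroundProj_mul_of_subset_holds : localGroundProj_mul_of_subset` —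
  `P_{B'} P_B = P_{B'}` for `B ⊆ B'`, where `P_B = localGroundProj Φ B` is the orthogonal
  projection onto the local ground space `⋂_{X ⊆ B} ker Φ X`.
* `Literature.QLattice.localGroundProj_isSupportedOn_holds : localGroundProj_isSupportedOn` — for a
  local interaction, `P_B ∈ 𝔄_B`: the local ground-state projection is of the form
  `P ⊗ 𝟙_{Λ∖B}` (`IsSupportedOn (localGroundProj Φ B) B`).

Auxiliary (general, on `projMatrix`): `projMatrix_mul_projMatrix_of_le` (`P_U P_V = P_U` for
`U ≤ V`) and its adjoint form `projMatrix_mul_projMatrix_of_ge` (`P_V P_U = P_U`);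
for a subspace `K ≤ (n → ℂ)` transported to `EuclideanSpace ℂ n` (the pattern of
`localGroundProj` and `Matrix.groundProj`): `mem_map_withLpLinearEquiv_symm_iff`,
`projMatrix_map_mulVec_mem` (`P_K v ∈ K`), `projMatrix_map_mulVec_of_mem` (`P_K k = k` on `K`) and
the **uniqueness of the orthogonal projection** `eq_projMatrix_map_of_mulVec` (a Hermitian matrix
fixing `K` pointwise and mapping into `K` is `P_K`). Specific: `localOp_projMatrix_eq_localGroundProj`
(`P_B = P_W ⊗ 𝟙_{Λ∖B}` for any subspace `W` of the `B`-factor squeezed between the slices of the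
local ground space and the joint kernel of the `B`-factors of the terms `Φ X`, `X ⊆ B`).

## Sources

* S. Michalakis, J. P. Zwolak, *Stability of frustration-free Hamiltonians*, Comm. Math. Phys.
  **322** (2013) 277–302 = arXiv:1109.1588. In the arXiv text (held copy, PDF p. 7), §4
  "Assumptions for Stability", Definition 3: "`P_B(ε)` [is] the projection onto the subspace of
  eigenstates of `H_B := Σ_{b_v(1) ⊂ B} Q_v` with energy at most `ε ≥ 0`. We set `P_B := P_B(0)`";
  Corollary 1, third claim: "`P_B(ε) P_C(0) = P_C(0)`, for `B ⊂ C` and `ε ≥ 0`", with the printed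
  proof "`H_C P_C(0) = 0` implies `H_B P_C(0) = 0` [...] `P_B(ε) P_C(0) = (P_B(ε) P_B(0)) P_C(0)
  = P_C(0)`". The named fact is the case `ε = 0` in the adjoint order `P_C P_B = P_C`
  (equivalent: all `P`'s are Hermitian).
  For the support of `P_B`: §2 (PDF p. 5), "(Spatially-local) [...] each interaction `Q_u` acts
  non-trivially on a Hilbert space supported on `b_u(1)`"; §4, Definition 3 (p. 7) as quoted; the
  support property `P_B ∈ 𝔄_B` is used in §6, proof of Proposition 2 (p. 14): "Note that
  `[P_{b_{j,a}(r)}, P_{b_{j,b}(r)}] = 0`, since the projectors have disjoint supports for `a ≠ b`"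
  (and on p. 13: "`Y_u(j)` and `Z_u(2q-1)` are supported on `b_j(u)` and `b_u(2q-1)`,
  respectively, and are annihilated by the local ground states"). MZ13 do not spell out the
  (elementary) proof; the tensor-factor argument below is the standard one.
* O. Bratteli, D. W. Robinson, *Operator Algebras and Quantum Statistical Mechanics II*
  (2nd ed., Springer 1997), §6.2.1: `𝓗_Λ = 𝓗_B ⊗ 𝓗_{Λ∖B}`, `𝔄_B ≅ 𝔄_B ⊗ 𝟙_{Λ∖B} ⊆ 𝔄_Λ`
  (the bookkeeping `localOp_mulVec_apply` / `localOp_mulVec_extend_val` of `SpinSystemProofs`).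

## Proof sketch (`localGroundProj_mul_of_subset_holds`)

`localGroundProj Φ B = projMatrix (map e (localGroundSpace Φ B))` with `e` the linear equivalence
`WithLp.linearEquiv⁻¹ : (TensorIndex Λ q → ℂ) ≃ EuclideanSpace ℂ _` and
`projMatrix K = toEuclideanCLM⁻¹ (K.starProjection)`. For `B ⊆ B'` the ground spaces are nested,
`localGroundSpace Φ B' ≤ localGroundSpace Φ B` (`localGroundSpace_antitone`, already proved in
`LTQO.lean`: a larger region imposes more constraints `Φ X ψ = 0`), `Submodule.map` is monotone,
and for nested subspaces `U ≤ V` of a Hilbert space Mathlib gives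
`U.starProjection ∘L V.starProjection = U.starProjection`
(`Submodule.starProjection_comp_starProjection_of_le`); transporting along the star-algebra
equivalence `Matrix.toEuclideanCLM` (`map_mul`) yields `P_U P_V = P_U`, i.e. `P_{B'} P_B = P_{B'}`.
No frustration-freeness is needed for this kernel-defined `P_B` (MZ13 need it only to identify
their spectrally-defined `P_B(0)` with the common kernel).

## Proof sketch (`localGroundProj_isSupportedOn_holds`)

Write `𝓗_Λ = 𝓗_B ⊗ 𝓗_{Λ∖B}` in the product basis: a vector `ψ : (Λ → Fin q) → ℂ` has the
`B`-slices `β ↦ ψ(β ⊔ σ|_{Λ∖B})` (`Subtype.val.extend β σ`), and `A ⊗ 𝟙 = localOp B A` acts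
slice-wise by `A` (`localOp_mulVec_apply`, `localOp_mulVec_extend_val`). For `X ⊆ B` locality
gives `Φ X = A_X ⊗ 𝟙_{Λ∖X} = A'_X ⊗ 𝟙_{Λ∖B}` with `A'_X = A_X ⊗ 𝟙_{B∖X}` (`localOp_embedOp_holds`).
Let `W = ⋂_{X ⊆ B} ⋂_{A' : A' ⊗ 𝟙 = Φ X} ker A' ≤ ℂ^{(B → Fin q)}` (the ground space of `H_B`
on the factor `𝓗_B`) and `N = P_W ⊗ 𝟙_{Λ∖B}`. Then (i) `N` is Hermitian; (ii) `N k = k` for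
`k ∈ K = localGroundSpace Φ B`, because every slice of `k` lies in `W` (`Φ X k = 0` slice-wise
reads `A'_X · slice = 0`) and `P_W` fixes `W`; (iii) `N v ∈ K` for every `v`, because the slices
of `N v` are `P_W · slice ∈ W`, killed by every `A'_X`. A Hermitian matrix with (ii) and (iii) is the orthogonal projection
onto `K` (`eq_projMatrix_map_of_mulVec`, from Mathlib's
`Submodule.eq_starProjection_of_mem_of_inner_eq_zero`: for `w ∈ K`,
`⟨u - N u, w⟩ = ⟨u, w⟩ - ⟨u, N w⟩ = ⟨u, w⟩ - ⟨u, w⟩ = 0`), so `P_B = N = P_W ⊗ 𝟙 ∈ 𝔄_B`.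
-/

noncomputable section

open Matrix

namespace Literature.MathematicalPhysics.QuantumLattice

section ProjMatrix

variable {n : Type*} [Fintype n] [DecidableEq n]

/-- Nested subspaces have nested projection matrices: `P_U P_V = P_U` for `U ≤ V` (Mathlib's
`Submodule.starProjection_comp_starProjection_of_le` transported along the star-algebra
equivalence `Matrix.toEuclideanCLM`, under which `projMatrix` is defined). [folklore] -/
theorem projMatrix_mul_projMatrix_of_le {U V : Submodule ℂ (EuclideanSpace ℂ n)} (h : U ≤ V) :
    projMatrix U * projMatrix V = projMatrix U := by
  rw [projMatrix, projMatrix, ← map_mul, ContinuousLinearMap.mul_def,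
    Submodule.starProjection_comp_starProjection_of_le h]

/-- The adjoint form `P_V P_U = P_U` for `U ≤ V` (`projMatrix_mul_projMatrix_of_le` and
`projMatrix_isHermitian`: `P_V P_U = (P_U P_V)ᴴ = P_Uᴴ = P_U`). [folklore] -/
theorem projMatrix_mul_projMatrix_of_ge {U V : Submodule ℂ (EuclideanSpace ℂ n)} (h : U ≤ V) :
    projMatrix V * projMatrix U = projMatrix U := by
  rw [← (projMatrix_isHermitian U).eq, ← (projMatrix_isHermitian V).eq, ← conjTranspose_mul,
    projMatrix_mul_projMatrix_of_le h]

end ProjMatrix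

section Discharge

variable {Λ : Type*} [Fintype Λ] [DecidableEq Λ] {q : ℕ}

/-- The transported local ground spaces are nested: for `B ⊆ B'`, the image of
`localGroundSpace Φ B'` in `EuclideanSpace ℂ (TensorIndex Λ q)` is contained in that of
`localGroundSpace Φ B` (`localGroundSpace_antitone` and `Submodule.map_mono`). MZ13 §4
(`P_C ≤ P_B` for `B ⊂ C`). [folklore] -/
theorem map_localGroundSpace_antitone (Φ : Interaction Λ q) {B B' : Finset Λ} (h : B ⊆ B') :
    (localGroundSpace Φ B').map
        ((WithLp.linearEquiv 2 ℂ (TensorIndex Λ q → ℂ)).symm :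
          (TensorIndex Λ q → ℂ) →ₗ[ℂ] EuclideanSpace ℂ (TensorIndex Λ q)) ≤
      (localGroundSpace Φ B).map
        ((WithLp.linearEquiv 2 ℂ (TensorIndex Λ q → ℂ)).symm :
          (TensorIndex Λ q → ℂ) →ₗ[ℂ] EuclideanSpace ℂ (TensorIndex Λ q)) :=
  Submodule.map_mono (localGroundSpace_antitone Φ h)

/-- **Discharge** of the named fact `localGroundProj_mul_of_subset`: `P_{B'} P_B = P_{B'}` for
`B ⊆ B'`. The local ground spaces are nested, `localGroundSpace Φ B' ≤ localGroundSpace Φ B`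
(`localGroundSpace_antitone`: enlarging the region adds constraints `Φ X ψ = 0`), the transport
`Submodule.map (WithLp.linearEquiv 2 ℂ _).symm` to `EuclideanSpace ℂ _` is monotone
(`map_localGroundSpace_antitone`), and nested subspaces have nested orthogonal projections
(`projMatrix_mul_projMatrix_of_le`, from Mathlib's
`Submodule.starProjection_comp_starProjection_of_le`).
Source: Michalakis–Zwolak, arXiv:1109.1588 §4, Definition 3 (`P_B := P_B(0)`, the projection
onto the zero-energy eigenstates of `H_B`) and Corollary 1, third claim: "`P_B(ε) P_C(0) = P_C(0)`,
for `B ⊂ C` and `ε ≥ 0`" (proof there: `H_C P_C(0) = 0` implies `H_B P_C(0) = 0` for a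
frustration-free `H`). The named fact is the `ε = 0` case written in the adjoint order
`P_C P_B = P_C` (equivalent, all `P`'s being Hermitian; the printed order is
`localGroundProj_mul_of_superset` below); for `localGroundProj`, defined through the common
kernel `⋂_{X ⊆ B} ker Φ X`, no frustration-freeness hypothesis is needed.
[cite: MichalakisZwolakCMP2013, §4 Corollary 1 (claim 3) (arXiv:1109.1588 p. 7)] -/
theorem localGroundProj_mul_of_subset_holds : localGroundProj_mul_of_subset (Λ := Λ) (q := q) :=
  fun Φ _ _ h => projMatrix_mul_projMatrix_of_le (map_localGroundSpace_antitone Φ h)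

/-- The printed order of MZ13 Corollary 1 (claim 3, `ε = 0`): `P_B P_C = P_C` for `B ⊆ C`
(`projMatrix_mul_projMatrix_of_ge`; equivalently the conjugate transpose of
`localGroundProj_mul_of_subset_holds`).
[cite: MichalakisZwolakCMP2013, §4 Corollary 1 (claim 3) (arXiv:1109.1588 p. 7)] -/
theorem localGroundProj_mul_of_superset (Φ : Interaction Λ q) {B C : Finset Λ} (h : B ⊆ C) :
    localGroundProj Φ B * localGroundProj Φ C = localGroundProj Φ C :=
  projMatrix_mul_projMatrix_of_ge (map_localGroundSpace_antitone Φ h)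

end Discharge

/-! ### Support of the local ground-state projection -/

section ProjMatrixMap

open scoped InnerProductSpace

variable {n : Type*}

/-- Membership in a subspace `K ≤ (n → ℂ)` transported to `EuclideanSpace ℂ n` along
`(WithLp.linearEquiv 2 ℂ (n → ℂ)).symm` (the pattern of `localGroundProj`, `Matrix.groundProj`):
`x ∈ K.map _ ↔ ofLp x ∈ K` (`Submodule.mem_map_equiv`). [folklore] -/
theorem mem_map_withLpLinearEquiv_symm_iff (K : Submodule ℂ (n → ℂ)) (x : EuclideanSpace ℂ n) :
    x ∈ K.map ((WithLp.linearEquiv 2 ℂ (n → ℂ)).symm : (n → ℂ) →ₗ[ℂ] EuclideanSpace ℂ n) ↔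
      WithLp.ofLp x ∈ K := by
  rw [Submodule.mem_map_equiv]
  rfl

variable [Fintype n] [DecidableEq n]

/-- The projection matrix onto (the transport of) `K ≤ (n → ℂ)` maps every vector into `K`
(`projMatrix_mulVec` and `Submodule.starProjection_apply_mem`). [folklore] -/
theorem projMatrix_map_mulVec_mem (K : Submodule ℂ (n → ℂ)) (v : n → ℂ) :
    projMatrix (K.map ((WithLp.linearEquiv 2 ℂ (n → ℂ)).symm : (n → ℂ) →ₗ[ℂ] EuclideanSpace ℂ n))
      *ᵥ v ∈ K := by
  have h1 := projMatrix_mulVec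
    (K.map ((WithLp.linearEquiv 2 ℂ (n → ℂ)).symm : (n → ℂ) →ₗ[ℂ] EuclideanSpace ℂ n))
    (WithLp.toLp 2 v)
  rw [WithLp.ofLp_toLp] at h1
  rw [h1]
  exact (mem_map_withLpLinearEquiv_symm_iff K _).1
    (Submodule.starProjection_apply_mem _ (WithLp.toLp 2 v))

/-- The projection matrix onto (the transport of) `K ≤ (n → ℂ)` fixes `K` pointwise
(`projMatrix_mulVec` and `Submodule.starProjection_eq_self_iff`). [folklore] -/
theorem projMatrix_map_mulVec_of_mem (K : Submodule ℂ (n → ℂ)) {v : n → ℂ} (hv : v ∈ K) :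
    projMatrix (K.map ((WithLp.linearEquiv 2 ℂ (n → ℂ)).symm : (n → ℂ) →ₗ[ℂ] EuclideanSpace ℂ n))
      *ᵥ v = v := by
  have h1 := projMatrix_mulVec
    (K.map ((WithLp.linearEquiv 2 ℂ (n → ℂ)).symm : (n → ℂ) →ₗ[ℂ] EuclideanSpace ℂ n))
    (WithLp.toLp 2 v)
  rw [WithLp.ofLp_toLp] at h1
  rw [h1]
  have h2 : (K.map ((WithLp.linearEquiv 2 ℂ (n → ℂ)).symm :
      (n → ℂ) →ₗ[ℂ] EuclideanSpace ℂ n)).starProjection (WithLp.toLp 2 v) = WithLp.toLp 2 v := by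
    rw [Submodule.starProjection_eq_self_iff, mem_map_withLpLinearEquiv_symm_iff]
    exact hv
  rw [h2, WithLp.ofLp_toLp]

/-- **Uniqueness of the orthogonal projection (matrix form).** A Hermitian matrix `N` which fixes
the subspace `K ≤ (n → ℂ)` pointwise and maps every vector into `K` is the projection matrix onto
(the transport to `EuclideanSpace ℂ n` of) `K`: for `w ∈ K`,
`⟪u - N u, w⟫ = ⟪u, w⟫ - ⟪u, N w⟫ = ⟪u, w⟫ - ⟪u, w⟫ = 0`, so `N u ∈ K` is the orthogonal
projection of `u`
(Mathlib's `Submodule.eq_starProjection_of_mem_of_inner_eq_zero`, transported along the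
star-algebra equivalence `Matrix.toEuclideanCLM` under which `projMatrix` is defined). [folklore] -/
theorem eq_projMatrix_map_of_mulVec (K : Submodule ℂ (n → ℂ)) {N : Matrix n n ℂ}
    (hN : N.IsHermitian) (hfix : ∀ k ∈ K, N *ᵥ k = k) (hmem : ∀ v, N *ᵥ v ∈ K) :
    N = projMatrix (K.map ((WithLp.linearEquiv 2 ℂ (n → ℂ)).symm :
      (n → ℂ) →ₗ[ℂ] EuclideanSpace ℂ n)) := by
  set K' : Submodule ℂ (EuclideanSpace ℂ n) := K.map ((WithLp.linearEquiv 2 ℂ (n → ℂ)).symm :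
      (n → ℂ) →ₗ[ℂ] EuclideanSpace ℂ n) with hK'
  have hsym : ∀ x y : EuclideanSpace ℂ n,
      ⟪Matrix.toEuclideanCLM (n := n) (𝕜 := ℂ) N x, y⟫_ℂ =
        ⟪x, Matrix.toEuclideanCLM (n := n) (𝕜 := ℂ) N y⟫_ℂ :=
    fun x y => (Matrix.isSymmetric_toEuclideanLin_iff.mpr hN) x y
  have hT : Matrix.toEuclideanCLM (n := n) (𝕜 := ℂ) N = K'.starProjection := by
    ext1 u
    symm
    apply Submodule.eq_starProjection_of_mem_of_inner_eq_zero
    · rw [hK', mem_map_withLpLinearEquiv_symm_iff, Matrix.ofLp_toEuclideanCLM]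
      exact hmem _
    · intro w hw
      rw [hK', mem_map_withLpLinearEquiv_symm_iff] at hw
      have hTw : Matrix.toEuclideanCLM (n := n) (𝕜 := ℂ) N w = w := by
        apply PiLp.ext
        intro i
        rw [Matrix.ofLp_toEuclideanCLM, hfix _ hw]
      rw [inner_sub_left, hsym u w, hTw, sub_self]
  change N = (Matrix.toEuclideanCLM (n := n) (𝕜 := ℂ)).symm K'.starProjection
  rw [← hT, StarAlgEquiv.symm_apply_apply]

end ProjMatrixMap

section Support

variable {Λ : Type*} [Fintype Λ] [DecidableEq Λ] {q : ℕ}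

/-- **`P_B = P_W ⊗ 𝟙_{Λ∖B}`.** Let `Φ` be a local interaction and `W ≤ ℂ^{(B → Fin q)}` a subspace
of the `B`-factor which contains all `B`-slices `β ↦ k(β ⊔ σ|_{Λ∖B})` of the local ground-state
vectors `k ∈ ⋂_{X ⊆ B} ker Φ X` and is annihilated by the `B`-factor `A'` of every term
`Φ X = A' ⊗ 𝟙_{Λ∖B}`, `X ⊆ B` (e.g. the ground space of `H_B` on the factor `𝓗_B`). Then
`P_W ⊗ 𝟙_{Λ∖B}` is the local ground-state projection `P_B`: it is Hermitian, fixes the local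
ground space (slice-wise `P_W` fixes `W`) and maps into it (slice-wise `A' P_W = 0`), hence equals
the orthogonal projection (`eq_projMatrix_map_of_mulVec`). Michalakis–Zwolak, arXiv:1109.1588,
§4 Definition 3 (`P_B`) with §2 "(Spatially-local)"; Bratteli–Robinson II §6.2.1
(`𝓗_Λ = 𝓗_B ⊗ 𝓗_{Λ∖B}`). [folklore] -/
theorem localOp_projMatrix_eq_localGroundProj {Φ : Interaction Λ q} (h : Φ.IsLocal)
    (B : Finset Λ) (W : Submodule ℂ ((B → Fin q) → ℂ))
    (hW₁ : ∀ k ∈ localGroundSpace Φ B, ∀ σ : TensorIndex Λ q,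
      (fun β => k (Subtype.val.extend β σ)) ∈ W)
    (hW₂ : ∀ w ∈ W, ∀ X, X ⊆ B → ∀ A' : Matrix (B → Fin q) (B → Fin q) ℂ,
      localOp B A' = Φ X → A' *ᵥ w = 0) :
    localOp B (projMatrix (W.map ((WithLp.linearEquiv 2 ℂ ((B → Fin q) → ℂ)).symm :
        ((B → Fin q) → ℂ) →ₗ[ℂ] EuclideanSpace ℂ (B → Fin q)))) = localGroundProj Φ B := by
  refine eq_projMatrix_map_of_mulVec (localGroundSpace Φ B) ?_ ?_ ?_
  · rw [IsHermitian, ← localOp_conjTranspose, (projMatrix_isHermitian _).eq]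
  · intro k hk
    funext σ
    rw [localOp_mulVec_apply, projMatrix_map_mulVec_of_mem W (hW₁ k hk σ)]
    simp only [extend_val_restrict]
  · intro v
    rw [mem_localGroundSpace_iff]
    intro X hX
    obtain ⟨A, hA⟩ := h.isSupportedOn X
    have hA' : localOp B (embedOp hX A) = Φ X := (localOp_embedOp_holds hX A).trans hA
    funext τ
    rw [← hA', localOp_mulVec_apply, localOp_mulVec_extend_val, Pi.zero_apply]
    exact congrFun (hW₂ _ (projMatrix_map_mulVec_mem W _) X hX _ hA') _

/-- **Discharge** of the named fact `localGroundProj_isSupportedOn`: for a local interaction the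
local ground-state projection `P_B` is supported on `B`, `P_B ∈ 𝔄_B`. Proof:
`P_B = P_W ⊗ 𝟙_{Λ∖B}` (`localOp_projMatrix_eq_localGroundProj`) for
`W = ⋂_{X ⊆ B} ⋂_{A' : A' ⊗ 𝟙 = Φ X} ker A'`, the ground space of `H_B` on the factor `𝓗_B`:
the slices of a local ground-state vector lie in `W` because `Φ X k = 0` reads slice-wise
`A' · (β ↦ k(β ⊔ σ|_{Λ∖B})) = 0` (`localOp_mulVec_extend_val`), and `W` is killed by every such
`A'` by definition.
Source: Michalakis–Zwolak, arXiv:1109.1588: §2 (PDF p. 5) "(Spatially-local) [...] each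
interaction `Q_u` acts non-trivially on a Hilbert space supported on `b_u(1)`"; §4 Definition 3
(p. 7) "`P_B(ε)` [is] the projection onto the subspace of eigenstates of
`H_B := Σ_{b_v(1) ⊂ B} Q_v` with energy at most `ε ≥ 0`. We set `P_B := P_B(0)`"; the support
property is used in §6, proof of Proposition 2 (p. 14): "Note that
`[P_{b_{j,a}(r)}, P_{b_{j,b}(r)}] = 0`, since the projectors have disjoint supports for `a ≠ b`."
For the kernel-defined `localGroundProj` no frustration-freeness is needed.
[cite: MichalakisZwolakCMP2013, §4 Definition 3 and §6 proof of Proposition 2 (arXiv:1109.1588 pp. 7, 14)] -/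
theorem localGroundProj_isSupportedOn_holds : localGroundProj_isSupportedOn (Λ := Λ) (q := q) := by
  intro Φ h B
  refine ⟨_, localOp_projMatrix_eq_localGroundProj h B
    (⨅ (X : Finset Λ) (_ : X ⊆ B) (A' : Matrix (B → Fin q) (B → Fin q) ℂ)
      (_ : localOp B A' = Φ X), LinearMap.ker (Matrix.toLin' A')) ?_ ?_⟩
  · intro k hk σ
    simp only [Submodule.mem_iInf, LinearMap.mem_ker, Matrix.toLin'_apply]
    intro X hX A' hA'
    rw [← localOp_mulVec_extend_val B A' k σ, hA', (mem_localGroundSpace_iff Φ B k).1 hk X hX]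
    rfl
  · intro w hw X hX A' hA'
    simp only [Submodule.mem_iInf, LinearMap.mem_ker, Matrix.toLin'_apply] at hw
    exact hw X hX A' hA'

end Support

end Literature.MathematicalPhysics.QuantumLattice
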